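import Mathlib.Analysis.SpecialFunctions.Trigonometric.Inverse
import Mathlib.Analysis.SpecialFunctions.Sqrt
import Summits.Ventures.PackingBounds.Configurations.TribonacciInt
import Summits.Ventures.PackingBounds.Configurations.SnubCube

/-!
# The vertex star of the snub cube closes exactly: `4 φ₁ + φ₂ = 2π`

Framing: lottery ticket; floor = certified bounds/negative ranges. Venture `PackingBounds` (cell
`pub-packcert`, seat `pub-packcert-recog`, gen 14). Kind (c)/method: an exact trigonometric identity
about the snub-cube configuration of `Configurations/SnubCube.lean` (Tammes `N = 24`), used in the
seat's conditional uniqueness argument (HOME `T3.md` §15 (d), (h)).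

Let `s = (τ² + 2τ - 2)/7 = cos θ₂₄` be the largest inner product between distinct vertices of the
snub cube (`τ` the tribonacci constant, `TribInt.tau`) and `u₃ = (2τ² + 4τ - 11)/7` the inner product
across the diagonal of a square face. Two unit vectors at inner product `s` with a common unit vector
`z` and azimuth difference `g` about `z` have inner product `s² + (1 - s²) cos g`; so nearest neighbours
of `z` that are nearest neighbours of each other are separated by the azimuth `φ₁ = arccos (s/(1+s))`,
and the two neighbours across the square face by `φ₂ = arccos ((u₃ - s²)/(1 - s²))`. We prove the
exact polynomial identity `T₄(s/(1+s)) = (u₃ - s²)/(1 - s²)` in `ℚ(τ)` (from `τ³ = τ² + τ + 1`) and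
deduce `4 φ₁ + φ₂ = 2π`: four triangles and one square corner fill the full angle at every vertex.
-/

namespace Summit.Ventures.PackingBounds.Config.SnubCubeStar

open TribInt (tau tau_cubic tau_gt tau_lt)

/-- `s = cos θ₂₄ = (τ² + 2τ - 2)/7`, the snub cube's largest inner product. -/
noncomputable def s : ℝ := (tau ^ 2 + 2 * tau - 2) / 7

/-- `u₃ = (2τ² + 4τ - 11)/7`, the inner product across the diagonal of a square face. -/
noncomputable def u3 : ℝ := (2 * tau ^ 2 + 4 * tau - 11) / 7

/-- `γ₁ = cos φ₁ = s/(1+s)`, cosine of the azimuth between adjacent nearest neighbours. -/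
noncomputable def γ1 : ℝ := s / (1 + s)

/-- `γ₂ = cos φ₂ = (u₃ - s²)/(1 - s²)`, cosine of the azimuth across the square corner. -/
noncomputable def γ2 : ℝ := (u3 - s ^ 2) / (1 - s ^ 2)

/-- Enclosure `0.72 < s`. -/
theorem s_gt : (0.72 : ℝ) < s := by
  unfold s; have h1 := tau_gt; have h2 := tau_lt; nlinarith

/-- Enclosure `s < 0.73`. -/
theorem s_lt : s < (0.73 : ℝ) := by
  unfold s; have h1 := tau_gt; have h2 := tau_lt; nlinarith

/-- The key exact identity in `ℚ(τ)`, denominators cleared: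
`(1 - s²)(8 s⁴ - 8 s² (1+s)² + (1+s)⁴) = (u₃ - s²)(1+s)⁴`. -/
theorem key_poly :
    (1 - s ^ 2) * (8 * s ^ 4 - 8 * s ^ 2 * (1 + s) ^ 2 + (1 + s) ^ 4) = (u3 - s ^ 2) * (1 + s) ^ 4 := by
  unfold s u3
  have h := tau_cubic
  linear_combination ((-990/2401 : ℝ) + (-218/343 : ℝ) * tau + (-870/2401 : ℝ) * tau ^ 2
    + (-114/2401 : ℝ) * tau ^ 3 + (18/343 : ℝ) * tau ^ 4 + (86/2401 : ℝ) * tau ^ 5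
    + (22/2401 : ℝ) * tau ^ 6 + (2/2401 : ℝ) * tau ^ 7) * h

/-- `T₄(γ₁) = γ₂`: `8 γ₁⁴ - 8 γ₁² + 1 = γ₂` exactly. -/
theorem T4_identity : 8 * γ1 ^ 4 - 8 * γ1 ^ 2 + 1 = γ2 := by
  have hs1 := s_gt; have hs2 := s_lt
  have h1 : (1 + s) ≠ 0 := by intro h; linarith
  have h2 : (1 - s ^ 2) ≠ 0 := by nlinarith
  have h14 : (1 + s) ^ 4 ≠ 0 := pow_ne_zero 4 h1
  unfold γ1 γ2
  rw [div_pow, div_pow, eq_div_iff h2]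
  have key := key_poly
  field_simp
  linear_combination key

/-- `0 < γ₁`. -/
theorem γ1_pos : 0 < γ1 := by
  unfold γ1; have := s_gt; positivity

/-- `γ₁ < √2/2`, i.e. `φ₁ > π/4`. -/
theorem γ1_lt : γ1 < Real.sqrt 2 / 2 := by
  have hs1 := s_gt; have hs2 := s_lt
  have hγ : γ1 < 0.43 := by
    unfold γ1; rw [div_lt_iff₀ (by linarith)]; nlinarith
  have hsq : (0.43 : ℝ) < Real.sqrt 2 / 2 := by
    rw [lt_div_iff₀ (by norm_num : (0:ℝ) < 2)]
    have : (0.86 : ℝ) < Real.sqrt 2 := by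
      rw [show (0.86 : ℝ) = Real.sqrt (0.86 ^ 2) by rw [Real.sqrt_sq (by norm_num)]]
      exact Real.sqrt_lt_sqrt (by norm_num) (by norm_num)
    linarith
  linarith

/-- `-1 ≤ γ₂ ≤ 1` (indeed `γ₂ ≈ -0.1607`). -/
theorem γ2_mem : -1 ≤ γ2 ∧ γ2 ≤ 1 := by
  rw [← T4_identity]
  have h0 := γ1_pos; have h1 := γ1_lt
  have hγ : γ1 < 0.75 := by
    have : Real.sqrt 2 / 2 < 0.75 := by
      rw [div_lt_iff₀ (by norm_num : (0:ℝ) < 2)]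
      have : Real.sqrt 2 < 1.5 := by
        rw [show (1.5 : ℝ) = Real.sqrt (1.5 ^ 2) by rw [Real.sqrt_sq (by norm_num)]]
        exact Real.sqrt_lt_sqrt (by norm_num) (by norm_num)
      linarith
    linarith
  constructor
  · nlinarith [sq_nonneg (2 * γ1 ^ 2 - 1)]
  · have hsq : γ1 ^ 2 ≤ 1 := by nlinarith
    have h2 : 0 ≤ γ1 ^ 2 := sq_nonneg _
    nlinarith [mul_nonneg h2 (sub_nonneg.mpr hsq)]

/-- **The vertex star of the snub cube closes**: `4 arccos γ₁ + arccos γ₂ = 2π`, i.e. around every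
vertex four equilateral spherical triangles (azimuth `φ₁` each) and one square corner (azimuth `φ₂`)
fill exactly the full angle. -/
theorem vertex_star_closes : 4 * Real.arccos γ1 + Real.arccos γ2 = 2 * Real.pi := by
  have hγ0 := γ1_pos
  have hγ1 := γ1_lt
  have hγ2 := γ2_mem
  -- φ := arccos γ₁ ∈ (π/4, π/2)
  have hφ_lt : Real.arccos γ1 < Real.pi / 2 := Real.arccos_lt_pi_div_two.mpr hγ0
  have hφ_gt : Real.pi / 4 < Real.arccos γ1 := by
    by_contra h
    have h' : Real.arccos γ1 ≤ Real.pi / 4 := not_lt.mp h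
    have := Real.arccos_le_pi_div_four.mp h'
    linarith
  -- cos (4 φ) = γ₂
  have hsq2 : Real.sqrt 2 / 2 ≤ 1 := by
    have h2 : Real.sqrt 2 ≤ 2 := by
      rw [show (2 : ℝ) = Real.sqrt (2 ^ 2) by rw [Real.sqrt_sq (by norm_num)]]
      exact Real.sqrt_le_sqrt (by norm_num)
    linarith
  have hcos : Real.cos (Real.arccos γ1) = γ1 := Real.cos_arccos (by linarith) (by linarith)
  have h4 : Real.cos (4 * Real.arccos γ1) = γ2 := by
    -- cos (4x) = 8 cos⁴ x - 8 cos² x + 1 (double angle twice), then the exact identity T₄(γ₁) = γ₂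
    have hc2 : Real.cos (2 * Real.arccos γ1) = 2 * Real.cos (Real.arccos γ1) ^ 2 - 1 :=
      Real.cos_two_mul _
    have hc4 : Real.cos (4 * Real.arccos γ1) = 2 * Real.cos (2 * Real.arccos γ1) ^ 2 - 1 := by
      rw [show (4 : ℝ) * Real.arccos γ1 = 2 * (2 * Real.arccos γ1) by ring]
      exact Real.cos_two_mul _
    rw [hc4, hc2, hcos, ← T4_identity]; ring
  -- ψ := 2π - 4φ ∈ (0, π) has cos ψ = γ₂, hence arccos γ₂ = ψ
  have hψ : Real.arccos γ2 = 2 * Real.pi - 4 * Real.arccos γ1 := by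
    have hc : Real.cos (2 * Real.pi - 4 * Real.arccos γ1) = γ2 := by
      rw [Real.cos_two_pi_sub, h4]
    rw [← hc, Real.arccos_cos (by linarith) (by linarith [Real.pi_pos])]
  linarith

/-! ### Tie to the configuration of `Configurations/SnubCube.lean` (appended, gen 14)

`s` and `u₃` are not free parameters: they are normalised keys of the snub cube's exact distance
table `Config.SnubCube.table` (dot products of the `ℤ[τ]` coordinate vectors `vecs`, common squared
length `q = 1 + 2τ`): `s = ι⟨0,0,1⟩/ι q` is the LARGEST key (multiplicity `5`: the five nearest
neighbours) and `u₃ = ι⟨-1,-2,2⟩/ι q` is the key of multiplicity `1` (`ι = TribInt.toReal`). -/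

/-- `s = τ²/(1 + 2τ)`: the largest (multiplicity-`5`) key of `Config.SnubCube.table`, normalised by `q`. -/
theorem s_eq_table_key : s = TribInt.toReal ⟨0, 0, 1⟩ / TribInt.toReal SnubCube.q := by
  have h := tau_cubic; have h1 := tau_gt
  have hq : (0 : ℝ) < TribInt.toReal SnubCube.q := by
    rw [TribInt.toReal_apply, SnubCube.q]; push_cast; nlinarith
  rw [eq_div_iff hq.ne', TribInt.toReal_apply, TribInt.toReal_apply, SnubCube.q, s]
  push_cast
  linear_combination (2/7 : ℝ) * h

/-- `(⟨0, 0, 1⟩, 5) ∈ Config.SnubCube.table`: the key behind `s` is the table's multiplicity-`5` entry. -/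
theorem s_key_mem_table : (⟨0, 0, 1⟩, 5) ∈ SnubCube.table := by decide

/-- `u₃ = (2τ² - 2τ - 1)/(1 + 2τ)`: the multiplicity-`1` key `⟨-1,-2,2⟩` of `Config.SnubCube.table`,
normalised by `q`. -/
theorem u3_eq_table_key : u3 = TribInt.toReal ⟨-1, -2, 2⟩ / TribInt.toReal SnubCube.q := by
  have h := tau_cubic; have h1 := tau_gt
  have hq : (0 : ℝ) < TribInt.toReal SnubCube.q := by
    rw [TribInt.toReal_apply, SnubCube.q]; push_cast; nlinarith
  rw [eq_div_iff hq.ne', TribInt.toReal_apply, TribInt.toReal_apply, SnubCube.q, u3]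
  push_cast
  linear_combination (4/7 : ℝ) * h

/-- `(⟨-1, -2, 2⟩, 1) ∈ Config.SnubCube.table`: the key behind `u₃` is a multiplicity-`1` entry. -/
theorem u3_key_mem_table : (⟨-1, -2, 2⟩, 1) ∈ SnubCube.table := by decide

/-- `s` is the largest normalised key: every key `d` of the table has `ι d/ι q ≤ s` (so `s = cos θ₂₄`,
the largest inner product between distinct points of `Config.SnubCube.pts`, cf. `SnubCube.inner_pts`). -/
theorem table_keys_le_s : ∀ p ∈ SnubCube.table, TribInt.toReal p.1 / TribInt.toReal SnubCube.q ≤ s := by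
  have h1 := tau_gt; have h2 := tau_lt; have h3 := tau_cubic
  have hq : (0 : ℝ) < TribInt.toReal SnubCube.q := by
    rw [TribInt.toReal_apply, SnubCube.q]; push_cast; nlinarith
  intro p hp
  rw [div_le_iff₀ hq, TribInt.toReal_apply, TribInt.toReal_apply, SnubCube.q, s]
  simp only [SnubCube.table, List.mem_cons, List.not_mem_nil, or_false] at hp
  rcases hp with rfl | rfl | rfl | rfl | rfl | rfl | rfl | rfl | rfl | rfl | rfl <;>
    push_cast <;> nlinarith

end Summit.Ventures.PackingBounds.Config.SnubCubeStar
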